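import Summits.ValiantsHypothesis.ValiantsHypothesis.Theorems.KPlusLogSqLawStaticPathHopsStraddle
import Summits.ValiantsHypothesis.ValiantsHypothesis.Theorems.KPlusLogSqLawStaticPathHighTipsBetween

/-!
# Route «KPlusLogSqLaw» — parametric max-weight independent set on a path: THEOREM T′ — for every slope threshold `λ`, at most `6n` hops straddle `λ`

HONEST FRAMING.  Helper toward the crux `WeakLifting` (item `stmt-ValiantsHypothesis-19561`, route `KPlusLogSqLaw`, cell `pub-symmetroid`,
seat val-sym-lift-p4 g21, 2026-08-29) on the line of its witness-plan stub `stub_tridiagonalSectorB` (tropical twin of the STATIC tridiagonal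
sector = parametric maximum-weight independent set on a path).  Completion of THEOREM T′ (THEOREM-T.md §4, val-sym-lift-p4 g14): the even–even
half **`hopsEven_straddle_card_le`** (events formed by two EVEN lines whose slopes straddle `λ` are at most `3n`, by the signed counting lemma over
the λ-HIGH tips of `…StaticPathHighTips*` plus THEOREM T) and, with the odd–odd half `…StaticPathHopsStraddle.hopsOdd_straddle_card_le`, the full
statement **`hops_straddle_card_le`**: for `n + 1` lines in general position and any slope threshold `λ` different from all slopes, the SAME-PARITY
events — the vacancy HOPS — whose two slopes straddle `λ` number at most `6n`.  Statements about a labelled line arrangement; nothing here asserts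
anything about `WeakLifting`, `TropicalB`, `KPlusLogSqLaw`, the stub in its window, `MatrixDescartes` (stmt-ValiantsHypothesis-18050) or `VP ≠ VNP`;
whether ALL hops are `O(n)` (the ORDER QUESTION) stays open — T′ bounds only the hops crossing a given `λ`.
-/

set_option linter.dupNamespace false
set_option autoImplicit false

namespace Summit.ValiantsHypothesis.ValiantsHypothesis.Theorems.KPlusLogSqLaw

open Finset Classical

namespace StaticPathFold

noncomputable section

variable (a b : ℕ → ℝ)

/-- **THEOREM T′, even–even half**: the pairs `p < q ≤ n` of EVEN lines with slopes straddling `λ` that are events ((M), (L), (R)) number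
at most `3 n` (mirror of `hopsOdd_straddle_card_le`, through the λ-high tips). [folklore] -/
theorem hopsEven_straddle_card_le (n : ℕ) (lam : ℝ)
    (hslope : ∀ p q, p ≤ n → q ≤ n → p ≠ q → a p ≠ a q) (hlam : ∀ p, p ≤ n → a p ≠ lam)
    (hgp : ∀ p q t, p ≤ n → q ≤ n → t ≤ n → p ≠ q → t ≠ p → t ≠ q →
      L a b t ((b q - b p) / (a p - a q)) ≠ L a b p ((b q - b p) / (a p - a q))) :
    (((range (n + 1)) ×ˢ (range (n + 1))).filter (fun pq : ℕ × ℕ => pq.1 < pq.2 ∧ pq.2 ≤ n ∧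
        (Even pq.1 ∧ Even pq.2 ∧ ((a pq.1 < lam ∧ lam < a pq.2) ∨ (a pq.2 < lam ∧ lam < a pq.1))) ∧
        (∀ t, pq.1 < t → t < pq.2 →
          0 < gap t (L a b pq.1 ((b pq.2 - b pq.1) / (a pq.1 - a pq.2))) (L a b t ((b pq.2 - b pq.1) / (a pq.1 - a pq.2)))) ∧
        (∃ r, Even r ∧ r ≤ pq.1 ∧
          (∀ t, pq.1 - r ≤ t → t < pq.1 →
            0 < gap t (L a b pq.1 ((b pq.2 - b pq.1) / (a pq.1 - a pq.2))) (L a b t ((b pq.2 - b pq.1) / (a pq.1 - a pq.2)))) ∧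
          (r = pq.1 ∨ ¬ 0 < gap (pq.1 - r - 1) (L a b pq.1 ((b pq.2 - b pq.1) / (a pq.1 - a pq.2)))
            (L a b (pq.1 - r - 1) ((b pq.2 - b pq.1) / (a pq.1 - a pq.2))))) ∧
        (∃ r, Even r ∧ pq.2 + r ≤ n ∧
          (∀ t, pq.2 < t → t ≤ pq.2 + r →
            0 < gap t (L a b pq.1 ((b pq.2 - b pq.1) / (a pq.1 - a pq.2))) (L a b t ((b pq.2 - b pq.1) / (a pq.1 - a pq.2)))) ∧
          (pq.2 + r = n ∨ ¬ 0 < gap (pq.2 + r + 1) (L a b pq.1 ((b pq.2 - b pq.1) / (a pq.1 - a pq.2)))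
            (L a b (pq.2 + r + 1) ((b pq.2 - b pq.1) / (a pq.1 - a pq.2))))))).card ≤ 3 * n := by
  -- the λ-type predicate and the correctness predicate
  set S : ℕ → ℕ → Prop := fun p q =>
    ((Even p ∧ Even q ∧ ((a p < lam ∧ lam < a q) ∨ (a q < lam ∧ lam < a p))) ∨
     (Odd (p + q) ∧ (if Even p then a q < a p else a p < a q) ∧ (if Even p then a p else a q) < lam) ∨
     (Odd (p + q) ∧ (if Even p then a p < a q else a q < a p) ∧ lam < (if Even p then a p else a q))) with hSdef
  have hS : ∀ p q, S p q ↔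
      ((Even p ∧ Even q ∧ ((a p < lam ∧ lam < a q) ∨ (a q < lam ∧ lam < a p))) ∨
       (Odd (p + q) ∧ (if Even p then a q < a p else a p < a q) ∧ (if Even p then a p else a q) < lam) ∨
       (Odd (p + q) ∧ (if Even p then a p < a q else a q < a p) ∧ lam < (if Even p then a p else a q))) := fun _ _ => Iff.rfl
  set G : ℕ → ℕ → ℕ → Prop := fun p q t =>
    0 < gap t (L a b p ((b q - b p) / (a p - a q))) (L a b t ((b q - b p) / (a p - a q))) with hGdef
  -- the signed count over λ-high tips
  have key := signed_card_le_of_unique_tips n G S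
    (fun i j p q p' q' h1 h2 h3 h4 h5 h6 h7 h8 h9 h10 =>
      highTip_unique a b lam S hS i j p q p' q' h1 h2 h3 h4 h5 h6 h7 h8 h9 h10)
    (fun i j₁ j₂ j₃ h12 h23 h3n h1 h3 => highTip_between a b lam S hS n hslope hlam hgp i j₁ j₂ j₃ h12 h23 h3n h1 h3)
  -- THEOREM T bounds the odd (mixed) part
  have hT := mixedEvents_card_le a b n hslope hgp
  -- compare the three sets
  set P : Finset (ℕ × ℕ) := (range (n + 1)) ×ˢ (range (n + 1)) with hP
  have hsub1 : P.filter (fun pq : ℕ × ℕ => pq.1 < pq.2 ∧ pq.2 ≤ n ∧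
        (Even pq.1 ∧ Even pq.2 ∧ ((a pq.1 < lam ∧ lam < a pq.2) ∨ (a pq.2 < lam ∧ lam < a pq.1))) ∧
        (∀ t, pq.1 < t → t < pq.2 → G pq.1 pq.2 t) ∧
        (∃ r, Even r ∧ r ≤ pq.1 ∧ (∀ t, pq.1 - r ≤ t → t < pq.1 → G pq.1 pq.2 t) ∧ (r = pq.1 ∨ ¬ G pq.1 pq.2 (pq.1 - r - 1))) ∧
        (∃ r, Even r ∧ pq.2 + r ≤ n ∧ (∀ t, pq.2 < t → t ≤ pq.2 + r → G pq.1 pq.2 t) ∧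
          (pq.2 + r = n ∨ ¬ G pq.1 pq.2 (pq.2 + r + 1)))) ⊆
      P.filter (fun pq : ℕ × ℕ => pq.1 < pq.2 ∧ pq.2 ≤ n ∧ S pq.1 pq.2 ∧
        (∀ t, pq.1 < t → t < pq.2 → G pq.1 pq.2 t) ∧
        (∃ r, Even r ∧ r ≤ pq.1 ∧ (∀ t, pq.1 - r ≤ t → t < pq.1 → G pq.1 pq.2 t) ∧ (r = pq.1 ∨ ¬ G pq.1 pq.2 (pq.1 - r - 1))) ∧
        (∃ r, Even r ∧ pq.2 + r ≤ n ∧ (∀ t, pq.2 < t → t ≤ pq.2 + r → G pq.1 pq.2 t) ∧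
          (pq.2 + r = n ∨ ¬ G pq.1 pq.2 (pq.2 + r + 1))) ∧ Even (pq.1 + pq.2)) := by
    intro pq hpq
    rw [mem_filter] at hpq ⊢
    obtain ⟨hP', hlt, hqn, ⟨hpe, hqe, hstr⟩, hM, hL, hR⟩ := hpq
    refine ⟨hP', hlt, hqn, Or.inl ⟨hpe, hqe, hstr⟩, hM, hL, hR, ?_⟩
    rw [Nat.even_add]
    exact ⟨fun _ => hqe, fun _ => hpe⟩
  have hsub2 : P.filter (fun pq : ℕ × ℕ => pq.1 < pq.2 ∧ pq.2 ≤ n ∧ S pq.1 pq.2 ∧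
        (∀ t, pq.1 < t → t < pq.2 → G pq.1 pq.2 t) ∧
        (∃ r, Even r ∧ r ≤ pq.1 ∧ (∀ t, pq.1 - r ≤ t → t < pq.1 → G pq.1 pq.2 t) ∧ (r = pq.1 ∨ ¬ G pq.1 pq.2 (pq.1 - r - 1))) ∧
        (∃ r, Even r ∧ pq.2 + r ≤ n ∧ (∀ t, pq.2 < t → t ≤ pq.2 + r → G pq.1 pq.2 t) ∧
          (pq.2 + r = n ∨ ¬ G pq.1 pq.2 (pq.2 + r + 1))) ∧ Odd (pq.1 + pq.2)) ⊆
      P.filter (fun pq : ℕ × ℕ => pq.1 < pq.2 ∧ pq.2 ≤ n ∧ Odd (pq.1 + pq.2) ∧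
        (∀ t, pq.1 < t → t < pq.2 → G pq.1 pq.2 t) ∧
        (∃ r, Even r ∧ r ≤ pq.1 ∧ (∀ t, pq.1 - r ≤ t → t < pq.1 → G pq.1 pq.2 t) ∧ (r = pq.1 ∨ ¬ G pq.1 pq.2 (pq.1 - r - 1))) ∧
        (∃ r, Even r ∧ pq.2 + r ≤ n ∧ (∀ t, pq.2 < t → t ≤ pq.2 + r → G pq.1 pq.2 t) ∧
          (pq.2 + r = n ∨ ¬ G pq.1 pq.2 (pq.2 + r + 1)))) := by
    intro pq hpq
    rw [mem_filter] at hpq ⊢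
    obtain ⟨hP', hlt, hqn, -, hM, hL, hR, hodd⟩ := hpq
    exact ⟨hP', hlt, hqn, hodd, hM, hL, hR⟩
  have h1 := card_le_card hsub1
  have h2 := card_le_card hsub2
  simp only [hGdef] at h1 h2 key hT ⊢
  omega

/-- **THEOREM T′ (hops across a slope threshold are at most `6n`).**  Lines `L a b 0, …, L a b n` with pairwise distinct slopes and no third line
through a crossing, `λ` different from every slope; the SAME-PARITY pairs `p < q ≤ n` (two floors or two ceilings — the vacancy hops) whose slopes
straddle `λ` and which are events ((M), (L), (R) of THEOREM T's vocabulary) number at most `6 n`. [folklore] -/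
theorem hops_straddle_card_le (n : ℕ) (lam : ℝ)
    (hslope : ∀ p q, p ≤ n → q ≤ n → p ≠ q → a p ≠ a q) (hlam : ∀ p, p ≤ n → a p ≠ lam)
    (hgp : ∀ p q t, p ≤ n → q ≤ n → t ≤ n → p ≠ q → t ≠ p → t ≠ q →
      L a b t ((b q - b p) / (a p - a q)) ≠ L a b p ((b q - b p) / (a p - a q))) :
    (((range (n + 1)) ×ˢ (range (n + 1))).filter (fun pq : ℕ × ℕ => pq.1 < pq.2 ∧ pq.2 ≤ n ∧
        ((Even pq.1 ↔ Even pq.2) ∧ ((a pq.1 < lam ∧ lam < a pq.2) ∨ (a pq.2 < lam ∧ lam < a pq.1))) ∧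
        (∀ t, pq.1 < t → t < pq.2 →
          0 < gap t (L a b pq.1 ((b pq.2 - b pq.1) / (a pq.1 - a pq.2))) (L a b t ((b pq.2 - b pq.1) / (a pq.1 - a pq.2)))) ∧
        (∃ r, Even r ∧ r ≤ pq.1 ∧
          (∀ t, pq.1 - r ≤ t → t < pq.1 →
            0 < gap t (L a b pq.1 ((b pq.2 - b pq.1) / (a pq.1 - a pq.2))) (L a b t ((b pq.2 - b pq.1) / (a pq.1 - a pq.2)))) ∧
          (r = pq.1 ∨ ¬ 0 < gap (pq.1 - r - 1) (L a b pq.1 ((b pq.2 - b pq.1) / (a pq.1 - a pq.2)))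
            (L a b (pq.1 - r - 1) ((b pq.2 - b pq.1) / (a pq.1 - a pq.2))))) ∧
        (∃ r, Even r ∧ pq.2 + r ≤ n ∧
          (∀ t, pq.2 < t → t ≤ pq.2 + r →
            0 < gap t (L a b pq.1 ((b pq.2 - b pq.1) / (a pq.1 - a pq.2))) (L a b t ((b pq.2 - b pq.1) / (a pq.1 - a pq.2)))) ∧
          (pq.2 + r = n ∨ ¬ 0 < gap (pq.2 + r + 1) (L a b pq.1 ((b pq.2 - b pq.1) / (a pq.1 - a pq.2)))
            (L a b (pq.2 + r + 1) ((b pq.2 - b pq.1) / (a pq.1 - a pq.2))))))).card ≤ 6 * n := by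
  have hO := hopsOdd_straddle_card_le a b n lam hslope hlam hgp
  have hE := hopsEven_straddle_card_le a b n lam hslope hlam hgp
  refine le_trans (card_le_card ?_) (le_trans (card_union_le _ _) (le_trans (add_le_add hO hE) (by omega)))
  intro pq hpq
  rw [mem_filter] at hpq
  obtain ⟨hP', hlt, hqn, ⟨hpar, hstr⟩, hM, hL, hR⟩ := hpq
  rw [mem_union, mem_filter, mem_filter]
  by_cases hpe : Even pq.1
  · exact Or.inr ⟨hP', hlt, hqn, ⟨hpe, hpar.mp hpe, hstr⟩, hM, hL, hR⟩
  · exact Or.inl ⟨hP', hlt, hqn, ⟨hpe, fun h => hpe (hpar.mpr h), hstr⟩, hM, hL, hR⟩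

end

end StaticPathFold

end Summit.ValiantsHypothesis.ValiantsHypothesis.Theorems.KPlusLogSqLaw
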